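import Mathlib
import HarnessLib
import HarnessLib.Audit
import Summits.CriticalPhenomena.PercolationContinuityZ3.Theorems.PercNearOneGluingNoHeavyLowerTailHexMSDeadMatching
import Summits.CriticalPhenomena.PercolationContinuityZ3.Theorems.PercNearOneGluingNoHeavyLowerTailHexMSMatchSaturated

/-!
# The pure SC inequality (Π2″) and what it gives: (MATCH*) for depth-one saturated two-class instances (hp-7 gen 71)

Support file for crux `stmt-CriticalPhenomena-4575` (route `PercNearOneGluingNoHeavy`), hull-port seat `prim-hp-7` (generation 71);
`--supports stmt-CriticalPhenomena-4575`.  No `sorry`.  Memo: `run/shared/lean/prim/prim-hp-7/FROM-prim-hp-7-g71-SATURATION.md` §0ter.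

Vocabulary of `…HexMSMatch*` (antipodal instance `(U, 𝒟, x)`, `dead`, `farProducts`, `farNbhd A = ⋃_{a ∈ A} farProducts a`).
By the saturation reduction (`…HexMSMatchSaturated`), Conjecture (MATCH) is the single inequality `#𝒟 ≤ #(farNbhd (dead 𝒟))` on
SATURATED instances.  This file isolates the PURE (label-free, instance-free) inequality behind the first layer of that statement.

* `PureSC α` — **Conjecture (Π2″)** (gen 71): for families `P, Q ⊆ 𝒫 U` with `P ⊔ Q` complement-free and a complement-free family `W` of
  'blocker representatives' `p \ q` or `p ∪ (U \ q)` that avoids `cl(P ∪ Q)` and `cl(P \\ P ∪ Q \\ Q)`, the term family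
  `T = P\\P ∪ Q\\Q ∪ P\\Q ∪ Q\\P ∪ P\\W ∪ W\\P ∪ Q ⊼ W ∪ Q ⊻ W` satisfies `2 (#P + #Q + #W) ≤ #cl T`.
  `W = ∅` is projective Marica–Schönheim (Δ-MS, `…LowerTailDeltaMS`, a theorem).  Exact by SAT on `2^[4]` (1 s) and `2^[5]` (488 s), and on `2^[6]` for
  pairwise-intersecting non-covering `P ⊔ Q` (72 s) (kit j250682); several natural strengthenings are false (memo §0ter).  An obligation (`def … : Prop`),
  never asserted.
* `card_le_card_farNbhd_of_pureSC` — **(Π2″) ⟹ (MATCH*) for depth-one saturated two-class instances**: if the dead members carry labels in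
  `{i, i+1, i+3, i+4}` and every alive member is a blocker (label `i+5`: of the form `p \ q` or `p ∪ (U \ q)` with `p, q` dead of labels `i, i+1`;
  label `i+2`: complement of such), then `#𝒟 ≤ #(farNbhd 𝒟 x (dead U 𝒟 x))`.  The real blocker family satisfies the two avoidance hypotheses of
  `PureSC` by the same-label lemma (`sdiff_notMem_of_dead_of_label_eq`) and because blockers are alive, and every term of `T` is a far product with a
  dead factor (`clU_scTerms_subset_farNbhd`).
-/

namespace Summit.CriticalPhenomena.PercolationContinuityZ3.Theorems

namespace GeneratedDonors

open Finset FinsetFamily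

variable {α : Type*} [DecidableEq α]

section PureSC

/-- Closure under complementation in `U`. -/
def clU (U : Finset α) (S : Finset (Finset α)) : Finset (Finset α) := S ∪ S.image fun s => U \ s

/-- The blocker representatives of the pair of blocks `(P, Q)`: `p \ q` and `p ∪ (U \ q)`. -/
def scReps (U : Finset α) (P Q : Finset (Finset α)) : Finset (Finset α) :=
  (P \\ Q) ∪ (P ×ˢ Q).image fun pq => pq.1 ∪ (U \ pq.2)

/-- The term family of (Π2″): differences inside and between the blocks and between `P` and `W`, meets and joins between `Q` and `W`. -/
def scTerms (P Q W : Finset (Finset α)) : Finset (Finset α) :=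
  (P \\ P) ∪ (Q \\ Q) ∪ (P \\ Q) ∪ (Q \\ P) ∪ (P \\ W) ∪ (W \\ P) ∪ (Q ⊼ W) ∪ (Q ⊻ W)

/-- **Conjecture (Π2″)** (hp-7 gen 71), the pure SC inequality.  An obligation, not a fact. -/
def PureSC (α : Type*) [DecidableEq α] : Prop :=
  ∀ (U : Finset α) (P Q W : Finset (Finset α)),
    (∀ a ∈ P ∪ Q ∪ W, a ⊆ U) →
    Disjoint P Q →
    (∀ a ∈ P ∪ Q, ∀ b ∈ P ∪ Q, a ≠ U \ b) →
    W ⊆ scReps U P Q →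
    (∀ a ∈ W, ∀ b ∈ W, a ≠ U \ b) →
    (∀ w ∈ W, w ∉ clU U ((P \\ P) ∪ (Q \\ Q))) →
    (∀ w ∈ W, w ∉ clU U (P ∪ Q)) →
    2 * (#P + #Q + #W) ≤ #(clU U (scTerms P Q W))

variable {U : Finset α} {S : Finset (Finset α)} {s : Finset α}

/-- Membership in `clU`. -/
theorem mem_clU : s ∈ clU U S ↔ s ∈ S ∨ ∃ t ∈ S, U \ t = s := by
  unfold clU; rw [mem_union, mem_image]

end PureSC

section Bridge

variable {U : Finset α} {𝒟 : Finset (Finset α)} {x : Finset α → ZMod 6}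

/-- `farNbhd` of the dead set is closed under complementation in `U`. -/
theorem compl_mem_farNbhd_dead (hU : ∀ a ∈ 𝒟, a ⊆ U) (hco : ∀ a ∈ 𝒟, U \ a ∈ 𝒟)
    (hanti : ∀ a ∈ 𝒟, x (U \ a) = x a + 3) {t : Finset α} (ht : t ∈ farNbhd 𝒟 x (dead U 𝒟 x)) :
    U \ t ∈ farNbhd 𝒟 x (dead U 𝒟 x) := by
  obtain ⟨a, ha, hp⟩ := mem_farNbhd.mp ht
  have haD : a ∈ 𝒟 := (mem_filter.mp ha).1
  refine mem_farNbhd.mpr ⟨U \ a, compl_mem_dead hU hco ha, ?_⟩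
  rw [farProducts_compl hU hco hanti haD]
  exact mem_image_of_mem _ hp

/-- A meet `a ∩ d` of a dead member `a` with a member `d` of far label lies in `farNbhd (dead)`. -/
theorem inter_mem_farNbhd_dead {a d : Finset α} (ha : a ∈ dead U 𝒟 x) (hd : d ∈ 𝒟) (hfar : ¬ Close (x a) (x d)) :
    a ∩ d ∈ farNbhd 𝒟 x (dead U 𝒟 x) :=
  mem_farNbhd.mpr ⟨a, ha, mem_farProducts.mpr ⟨d, hd, hfar, Or.inl rfl⟩⟩

/-- A join `a ∪ d` of a dead member `a` with a member `d` of far label lies in `farNbhd (dead)`. -/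
theorem union_mem_farNbhd_dead {a d : Finset α} (ha : a ∈ dead U 𝒟 x) (hd : d ∈ 𝒟) (hfar : ¬ Close (x a) (x d)) :
    a ∪ d ∈ farNbhd 𝒟 x (dead U 𝒟 x) :=
  mem_farNbhd.mpr ⟨a, ha, mem_farProducts.mpr ⟨d, hd, hfar, Or.inr rfl⟩⟩

/-- A difference `a \ b = a ∩ (U \ b)` of a dead member `a ⊆ U` with a member `b` such that `x a` is far from `x b + 3` lies in `farNbhd (dead)`. -/
theorem sdiff_mem_farNbhd_dead (hU : ∀ a ∈ 𝒟, a ⊆ U) (hco : ∀ a ∈ 𝒟, U \ a ∈ 𝒟)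
    (hanti : ∀ a ∈ 𝒟, x (U \ a) = x a + 3) {a b : Finset α} (ha : a ∈ dead U 𝒟 x) (hb : b ∈ 𝒟)
    (hfar : ¬ Close (x a) (x b + 3)) : a \ b ∈ farNbhd 𝒟 x (dead U 𝒟 x) := by
  have haD : a ∈ 𝒟 := (mem_filter.mp ha).1
  have h1 : a \ b = a ∩ (U \ b) := by
    rw [← sdiff_univ_compl_eq_inter (hU a haD), Finset.sdiff_sdiff_eq_self (hU b hb)]
  rw [h1]
  exact inter_mem_farNbhd_dead ha (hco b hb) (by rw [hanti b hb]; exact hfar)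

/-- A difference `b \ a = (U \ a) ∩ b` with `a` dead, `b` a member and `x a + 3` far from `x b` lies in `farNbhd (dead)`. -/
theorem sdiff_mem_farNbhd_dead' (hU : ∀ a ∈ 𝒟, a ⊆ U) (hco : ∀ a ∈ 𝒟, U \ a ∈ 𝒟)
    (hanti : ∀ a ∈ 𝒟, x (U \ a) = x a + 3) {a b : Finset α} (ha : a ∈ dead U 𝒟 x) (hb : b ∈ 𝒟)
    (hfar : ¬ Close (x a + 3) (x b)) : b \ a ∈ farNbhd 𝒟 x (dead U 𝒟 x) := by
  have haD : a ∈ 𝒟 := (mem_filter.mp ha).1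
  have h1 : b \ a = (U \ a) ∩ b := by
    rw [inter_comm, ← sdiff_univ_compl_eq_inter (hU b hb), Finset.sdiff_sdiff_eq_self (hU a haD)]
  rw [h1]
  exact inter_mem_farNbhd_dead (compl_mem_dead hU hco ha) hb (by rw [hanti a haD]; exact hfar)

/-- ZMod 6 bookkeeping for the two classes `i`, `i+1` and the blocker label `i+5`. -/
theorem far_facts (i : ZMod 6) :
    ¬ Close i (i + 3) ∧ ¬ Close (i + 1) (i + 1 + 3) ∧ ¬ Close i (i + 1 + 3) ∧ ¬ Close (i + 1) (i + 3) ∧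
    ¬ Close i (i + 5 + 3) ∧ ¬ Close (i + 3) (i + 5) ∧ ¬ Close (i + 1) (i + 5) := by
  revert i; decide

/-- **Every term of (Π2″) for the real blocks and blockers is a far product with a dead factor.**  Here `P, Q ⊆ dead` carry labels `i, i+1`
and `W ⊆ 𝒟` carries label `i+5`. -/
theorem clU_scTerms_subset_farNbhd (hU : ∀ a ∈ 𝒟, a ⊆ U) (hco : ∀ a ∈ 𝒟, U \ a ∈ 𝒟)
    (hanti : ∀ a ∈ 𝒟, x (U \ a) = x a + 3) (i : ZMod 6) {P Q W : Finset (Finset α)}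
    (hP : ∀ p ∈ P, p ∈ dead U 𝒟 x ∧ x p = i) (hQ : ∀ q ∈ Q, q ∈ dead U 𝒟 x ∧ x q = i + 1)
    (hW : ∀ w ∈ W, w ∈ 𝒟 ∧ x w = i + 5) :
    clU U (scTerms P Q W) ⊆ farNbhd 𝒟 x (dead U 𝒟 x) := by
  obtain ⟨f03, f14, f04, f13, f08, f35, f15⟩ := far_facts i
  have hdD : ∀ {a}, a ∈ dead U 𝒟 x → a ∈ 𝒟 := fun ha => (mem_filter.mp ha).1
  -- the terms themselves
  have hT : scTerms P Q W ⊆ farNbhd 𝒟 x (dead U 𝒟 x) := by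
    intro t ht
    unfold scTerms at ht
    simp only [mem_union] at ht
    rcases ht with ((((((h | h) | h) | h) | h) | h) | h) | h
    · obtain ⟨a, ha, b, hb, rfl⟩ := mem_diffs.mp h
      exact sdiff_mem_farNbhd_dead hU hco hanti (hP a ha).1 (hdD (hP b hb).1) (by rw [(hP a ha).2, (hP b hb).2]; exact f03)
    · obtain ⟨a, ha, b, hb, rfl⟩ := mem_diffs.mp h
      exact sdiff_mem_farNbhd_dead hU hco hanti (hQ a ha).1 (hdD (hQ b hb).1) (by rw [(hQ a ha).2, (hQ b hb).2]; exact f14)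
    · obtain ⟨a, ha, b, hb, rfl⟩ := mem_diffs.mp h
      exact sdiff_mem_farNbhd_dead hU hco hanti (hP a ha).1 (hdD (hQ b hb).1) (by rw [(hP a ha).2, (hQ b hb).2]; exact f04)
    · obtain ⟨a, ha, b, hb, rfl⟩ := mem_diffs.mp h
      exact sdiff_mem_farNbhd_dead hU hco hanti (hQ a ha).1 (hdD (hP b hb).1) (by rw [(hQ a ha).2, (hP b hb).2]; exact f13)
    · obtain ⟨a, ha, b, hb, rfl⟩ := mem_diffs.mp h
      exact sdiff_mem_farNbhd_dead hU hco hanti (hP a ha).1 (hW b hb).1 (by rw [(hP a ha).2, (hW b hb).2]; exact f08)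
    · obtain ⟨a, ha, b, hb, rfl⟩ := mem_diffs.mp h
      exact sdiff_mem_farNbhd_dead' hU hco hanti (hP b hb).1 (hW a ha).1 (by rw [(hP b hb).2, (hW a ha).2]; exact f35)
    · obtain ⟨a, ha, b, hb, rfl⟩ := mem_infs.mp h
      exact inter_mem_farNbhd_dead (hQ a ha).1 (hW b hb).1 (by rw [(hQ a ha).2, (hW b hb).2]; exact f15)
    · obtain ⟨a, ha, b, hb, rfl⟩ := mem_sups.mp h
      exact union_mem_farNbhd_dead (hQ a ha).1 (hW b hb).1 (by rw [(hQ a ha).2, (hW b hb).2]; exact f15)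
  intro t ht
  rcases mem_clU.mp ht with h | ⟨u, hu, rfl⟩
  · exact hT h
  · exact compl_mem_farNbhd_dead hU hco hanti (hT hu)

/-- ZMod 6 bookkeeping: label (in)equalities used for the blocks. -/
theorem label_facts (i : ZMod 6) :
    i ≠ i + 1 ∧ i + 3 ≠ i ∧ i + 3 ≠ i + 1 ∧ i + 1 + 3 ≠ i ∧ i + 1 + 3 ≠ i + 1 ∧ i + 5 + 3 ≠ i + 5 ∧
    i + 5 ≠ i ∧ i + 5 ≠ i + 1 ∧ i + 2 ≠ i ∧ i + 2 ≠ i + 1 ∧ i + 2 ≠ i + 5 ∧ i + 5 ≠ i + 3 ∧ i + 5 ≠ i + 4 ∧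
    i + 3 + 3 = i ∧ i + 4 + 3 = i + 1 ∧ i + 2 + 3 = i + 5 := by
  revert i; decide

/-- **(Π2″) ⟹ (MATCH*) for depth-one saturated two-class instances.**  If every dead member has a label in `{i, i+1, i+3, i+4}` and every
alive member is a blocker — of label `i+5` and of the form `p \ q` or `p ∪ (U \ q)` with `p, q` dead of labels `i, i+1`, or the complement of
such a member — then the pure SC inequality gives `#𝒟 ≤ #(farNbhd (dead))`, i.e. Hall's condition for the whole dead set
(`card_le_card_biUnion_farProducts_iff`). -/
theorem card_le_card_farNbhd_of_pureSC (hSC : PureSC α) (hU : ∀ a ∈ 𝒟, a ⊆ U) (hco : ∀ a ∈ 𝒟, U \ a ∈ 𝒟)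
    (hanti : ∀ a ∈ 𝒟, x (U \ a) = x a + 3) (i : ZMod 6)
    (hlab : ∀ a ∈ dead U 𝒟 x, x a = i ∨ x a = i + 1 ∨ x a = i + 3 ∨ x a = i + 4)
    (hdepth : ∀ d ∈ 𝒟, d ∉ dead U 𝒟 x →
      (x d = i + 5 ∧ d ∈ scReps U ((dead U 𝒟 x).filter fun a => x a = i) ((dead U 𝒟 x).filter fun a => x a = i + 1)) ∨
      (x d = i + 2 ∧ U \ d ∈ scReps U ((dead U 𝒟 x).filter fun a => x a = i) ((dead U 𝒟 x).filter fun a => x a = i + 1))) :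
    #𝒟 ≤ #(farNbhd 𝒟 x (dead U 𝒟 x)) := by
  classical
  obtain ⟨n01, n30, n31, n40, n41, n85, n50, n51, n20, n21, n25, n53, n54, e33, e43, e23⟩ := label_facts i
  set P : Finset (Finset α) := (dead U 𝒟 x).filter fun a => x a = i with hPdef
  set Q : Finset (Finset α) := (dead U 𝒟 x).filter fun a => x a = i + 1 with hQdef
  set W : Finset (Finset α) := (𝒟 \ dead U 𝒟 x).filter fun a => x a = i + 5 with hWdef
  have hP : ∀ p ∈ P, p ∈ dead U 𝒟 x ∧ x p = i := fun p hp => by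
    have h := mem_filter.mp hp; exact ⟨h.1, h.2⟩
  have hQ : ∀ q ∈ Q, q ∈ dead U 𝒟 x ∧ x q = i + 1 := fun q hq => by
    have h := mem_filter.mp hq; exact ⟨h.1, h.2⟩
  have hW : ∀ w ∈ W, (w ∈ 𝒟 ∧ w ∉ dead U 𝒟 x) ∧ x w = i + 5 := fun w hw => by
    have h := mem_filter.mp hw; exact ⟨mem_sdiff.mp h.1, h.2⟩
  have hdD : ∀ {a}, a ∈ dead U 𝒟 x → a ∈ 𝒟 := fun ha => (mem_filter.mp ha).1
  have hcc : ∀ {a}, a ⊆ U → U \ (U \ a) = a := fun ha => Finset.sdiff_sdiff_eq_self ha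
  -- the hypotheses of PureSC for (P, Q, W)
  have h1 : ∀ a ∈ P ∪ Q ∪ W, a ⊆ U := by
    intro a ha
    simp only [mem_union] at ha
    rcases ha with (ha | ha) | ha
    · exact hU a (hdD (hP a ha).1)
    · exact hU a (hdD (hQ a ha).1)
    · exact hU a (hW a ha).1.1
  have h2 : Disjoint P Q := by
    rw [Finset.disjoint_left]
    intro a haP haQ
    exact n01 ((hP a haP).2.symm.trans (hQ a haQ).2)
  have hPQlab : ∀ a ∈ P ∪ Q, a ∈ dead U 𝒟 x ∧ (x a = i ∨ x a = i + 1) := by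
    intro a ha
    rcases mem_union.mp ha with ha | ha
    · exact ⟨(hP a ha).1, Or.inl (hP a ha).2⟩
    · exact ⟨(hQ a ha).1, Or.inr (hQ a ha).2⟩
  have h3 : ∀ a ∈ P ∪ Q, ∀ b ∈ P ∪ Q, a ≠ U \ b := by
    intro a ha b hb hab
    have hxa := (hPQlab a ha).2
    have hxb : x a = x b + 3 := by rw [hab]; exact hanti b (hdD (hPQlab b hb).1)
    rcases (hPQlab b hb).2 with hb0 | hb1
    · rw [hb0] at hxb
      rcases hxa with h | h
      · exact n30 (hxb.symm.trans h)
      · exact n31 (hxb.symm.trans h)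
    · rw [hb1] at hxb
      rcases hxa with h | h
      · exact n40 (hxb.symm.trans h)
      · exact n41 (hxb.symm.trans h)
  have h4 : W ⊆ scReps U P Q := by
    intro w hw
    obtain ⟨⟨hwD, hwa⟩, hxw⟩ := hW w hw
    rcases hdepth w hwD hwa with ⟨-, h⟩ | ⟨h2', -⟩
    · exact h
    · exact absurd (hxw.symm.trans h2') n25.symm
  have h5 : ∀ a ∈ W, ∀ b ∈ W, a ≠ U \ b := by
    intro a ha b hb hab
    have hxa := (hW a ha).2
    have hxb : x a = x b + 3 := by rw [hab]; exact hanti b (hW b hb).1.1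
    rw [(hW b hb).2] at hxb
    exact n85 (hxb.symm.trans hxa)
  have h6 : ∀ w ∈ W, w ∉ clU U ((P \\ P) ∪ (Q \\ Q)) := by
    intro w hw hmem
    obtain ⟨⟨hwD, -⟩, -⟩ := hW w hw
    -- a within-block difference of dead members with equal labels is never a member, nor is its complement
    have key : ∀ t ∈ (P \\ P) ∪ (Q \\ Q), t ∉ 𝒟 ∧ t ⊆ U := by
      intro t ht
      rcases mem_union.mp ht with ht | ht
      · obtain ⟨a, ha, b, hb, rfl⟩ := mem_diffs.mp ht
        have hda := hP a ha; have hdb := hP b hb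
        refine ⟨(sdiff_notMem_of_dead_of_label_eq hU hco hanti (hdD hda.1) (hdD hdb.1) (mem_filter.mp hda.1).2
          (mem_filter.mp hdb.1).2 (hda.2.trans hdb.2.symm)).2, sdiff_subset.trans (hU a (hdD hda.1))⟩
      · obtain ⟨a, ha, b, hb, rfl⟩ := mem_diffs.mp ht
        have hda := hQ a ha; have hdb := hQ b hb
        refine ⟨(sdiff_notMem_of_dead_of_label_eq hU hco hanti (hdD hda.1) (hdD hdb.1) (mem_filter.mp hda.1).2
          (mem_filter.mp hdb.1).2 (hda.2.trans hdb.2.symm)).2, sdiff_subset.trans (hU a (hdD hda.1))⟩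
    rcases mem_clU.mp hmem with h | ⟨t, ht, rfl⟩
    · exact (key w h).1 hwD
    · have := hco _ hwD
      rw [hcc (key t ht).2] at this
      exact (key t ht).1 this
  have h7 : ∀ w ∈ W, w ∉ clU U (P ∪ Q) := by
    intro w hw hmem
    obtain ⟨⟨hwD, hwa⟩, -⟩ := hW w hw
    rcases mem_clU.mp hmem with h | ⟨t, ht, rfl⟩
    · exact hwa (hPQlab w h).1
    · have hdead : U \ (U \ t) ∈ dead U 𝒟 x := compl_mem_dead hU hco (compl_mem_dead hU hco (hPQlab t ht).1)
      rw [hcc (hU t (hdD (hPQlab t ht).1))] at hdead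
      exact hwa (compl_mem_dead hU hco (hPQlab t ht).1)
  -- the pure inequality and the embedding of the terms
  have hineq := hSC U P Q W h1 h2 h3 h4 h5 h6 h7
  have hsub : clU U (scTerms P Q W) ⊆ farNbhd 𝒟 x (dead U 𝒟 x) :=
    clU_scTerms_subset_farNbhd hU hco hanti i hP hQ (fun w hw => ⟨(hW w hw).1.1, (hW w hw).2⟩)
  -- counting 𝒟: every member or its complement lies in P ∪ Q ∪ W
  set A : Finset (Finset α) := 𝒟.filter fun d => x d = i ∨ x d = i + 1 ∨ x d = i + 5 with hAdef
  set B : Finset (Finset α) := 𝒟.filter fun d => ¬ (x d = i ∨ x d = i + 1 ∨ x d = i + 5) with hBdef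
  have hmemPQW : ∀ d ∈ 𝒟, (x d = i ∨ x d = i + 1 ∨ x d = i + 5) → d ∈ P ∪ Q ∪ W := by
    intro d hd hx
    simp only [mem_union]
    by_cases hdead : d ∈ dead U 𝒟 x
    · rcases hx with h | h | h
      · exact Or.inl (Or.inl (mem_filter.mpr ⟨hdead, h⟩))
      · exact Or.inl (Or.inr (mem_filter.mpr ⟨hdead, h⟩))
      · exfalso
        rcases hlab d hdead with h' | h' | h' | h'
        · exact n50 (h.symm.trans h')
        · exact n51 (h.symm.trans h')
        · exact n53 (h.symm.trans h')
        · exact n54 (h.symm.trans h')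
    · rcases hdepth d hd hdead with ⟨h5', -⟩ | ⟨h2', -⟩
      · exact Or.inr (mem_filter.mpr ⟨mem_sdiff.mpr ⟨hd, hdead⟩, h5'⟩)
      · exfalso
        rcases hx with h | h | h
        · exact n20 (h2'.symm.trans h)
        · exact n21 (h2'.symm.trans h)
        · exact n25 (h2'.symm.trans h)
  have hA : A ⊆ P ∪ Q ∪ W := fun d hd => hmemPQW d (mem_filter.mp hd).1 (mem_filter.mp hd).2
  have hB : B.image (fun d => U \ d) ⊆ P ∪ Q ∪ W := by
    intro e he
    obtain ⟨d, hd, rfl⟩ := mem_image.mp he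
    obtain ⟨hdD, hnot⟩ := mem_filter.mp hd
    refine hmemPQW (U \ d) (hco d hdD) ?_
    rw [hanti d hdD]
    by_cases hdead : d ∈ dead U 𝒟 x
    · rcases hlab d hdead with h | h | h | h
      · exact absurd (Or.inl h) hnot
      · exact absurd (Or.inr (Or.inl h)) hnot
      · rw [h]; exact Or.inl e33
      · rw [h]; exact Or.inr (Or.inl e43)
    · rcases hdepth d hdD hdead with ⟨h5', -⟩ | ⟨h2', -⟩
      · exact absurd (Or.inr (Or.inr h5')) hnot
      · rw [h2']; exact Or.inr (Or.inr e23)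
  have hinjB : Set.InjOn (fun d : Finset α => U \ d) ↑B := by
    intro d hd e he hde
    have hdU : d ⊆ U := hU d (mem_filter.mp (mem_coe.mp hd)).1
    have heU : e ⊆ U := hU e (mem_filter.mp (mem_coe.mp he)).1
    have h1 := congrArg (fun t => U \ t) hde
    simp only [hcc hdU, hcc heU] at h1
    exact h1
  have hsplit : #A + #B = #𝒟 := card_filter_add_card_filter_not _
  have hcardA : #A ≤ #(P ∪ Q ∪ W) := card_le_card hA
  have hcardB : #B ≤ #(P ∪ Q ∪ W) := by
    rw [← card_image_of_injOn hinjB]; exact card_le_card hB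
  have hunion : #(P ∪ Q ∪ W) ≤ #P + #Q + #W :=
    (card_union_le _ _).trans (Nat.add_le_add_right (card_union_le _ _) _)
  have hT := card_le_card hsub
  omega

end Bridge

end GeneratedDonors

end Summit.CriticalPhenomena.PercolationContinuityZ3.Theorems
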